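import Summits.BirchSwinnertonDyer.BirchSwinnertonDyer.Theorems.KolyvaginDepthDoorDepthTableRowKitOfPrint
import Summits.BirchSwinnertonDyer.BirchSwinnertonDyer.Theorems.KolyvaginDepthDoorDepthTableRows3
import Summits.BirchSwinnertonDyer.BirchSwinnertonDyer.Theorems.KolyvaginDepthDoorDepthTableRows4
import Summits.BirchSwinnertonDyer.BirchSwinnertonDyer.Theorems.KolyvaginDepthDoorDepthTableRows5
import Summits.BirchSwinnertonDyer.BirchSwinnertonDyer.Theorems.KolyvaginDepthDoorDepthTableOddPrimeKit
import Summits.BirchSwinnertonDyer.BirchSwinnertonDyer.Theorems.Rank1ResidualIntModelReduction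
import Literature.NumberTheory.EllipticCurves.ComplexMultiplicationNotSemistable
import HarnessLib

/-!
# Route `KolyvaginDepthDoor` — DEPTH-TABLE rows WITHOUT Kolyvagin's structure theorem (4/5):
# `681c1` `(5, -83, 19)`, `707a1` `(5, -19, 179)`, `794a1` `(5, -23, 89)` (crux `KolyvaginDepthSupply`, stmt-BirchSwinnertonDyer-21765)

Helper file (`--supports stmt-BirchSwinnertonDyer-21765 --as helper`); it closes nothing and BSD is
not proved by it. Continuation of `…DepthTableRowsOfPrint1` (rows `389a1`, `709a1`, `718b1`): the
rows of `…DepthTableRows3/4/5` rewritten over the row kit WITHOUT `hF`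
(`depthRow_of_print_of_intModel_certificate`, file `…DepthTableRowKitOfPrint`; engine: Kolyvagin's
minimal-depth descent, `Literature…HeegnerPointsKolyvaginDepthDescent`, proved as algebra), with the
two extra kernel side conditions discharged per curve: `p ∈ B(E)` (the `p`-adic tower surjectivity,
`hasSurjectiveModNGaloisRep_pow_of_intModel_certificate`: semistability, an irreducibility witness,
and a multiplicative prime `ℓ₀ ∥ Δ`) and `¬ HasCM` (multiplicative reduction at `ℓ₀`).

Each row: for ANY imaginary quadratic `K` with the row's `d_K`, any frame and any COMPATIBLE system of
Kolyvagin–Heegner data, granted the five named leaves `sign_conjAct_kolyvaginClass` (Gross 5.4 (2)),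
`lemma43_kolyvaginClass_mem_selmerLocalKer` (McCallum L4.3), `prop44_localOrder_kolyvaginClass_mul_eq`
(P4.4), `lemma53_selmer_eigen_dependent_at` (L5.3), `prop22_reciprocity_eigen_finset` (P2.2+L5.3):
bit `c_1(ℓ) ≠ 0` + one rational point of infinite order on the twist ⟹ `corank_{ℤ_p} Ш(E)[p^∞] = 0`,
`rank E(ℚ) = 2`, `rank E^{(d_K)}(ℚ) = 1`. Honest trade versus the hF-rows: Kolyvagin Thm. 4 (XL) ↦
five S/M leaves + the SYSTEM of data + one twist point. The three additive curves of the table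
(`664a1`, `916c1`, `944e1`) are not treated here (the tower certificate used is the semistable one).
Per-curve; BSD is not proved by it.
-/

set_option linter.dupNamespace false

noncomputable section

open scoped Classical NumberField

namespace Summit.BirchSwinnertonDyer.BirchSwinnertonDyer.Theorems.KolyvaginDepthDoor

open Literature.NumberTheory.EllipticCurves Literature.NumberTheory.EllipticCurves.ModularForms
  Literature.NumberTheory.EllipticCurves.McCallum1991 WeierstrassCurve
open Summit.BirchSwinnertonDyer.BirchSwinnertonDyer.Rank2Observatory
open Summit.BirchSwinnertonDyer.BirchSwinnertonDyer.Rank1Residual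

/-! ## Row `681c1` = `[0,-1,1,0,2]` (`N = 681, |Δ| = 3²·227`): `(p, d_K, ℓ) = (5, -83, 19)` -/

namespace C681c1

/-- **`5 ∈ B(681c1)`: `ρ̄_{E,5^m}` onto for every `m`** (semistable `gcd(c₄, Δ) = 1`;
`X² − a_13 X + 13`, `a_13 = -2`, root-free mod `5`: `E[5]` irreducible (Mazur 6.3), onto (Serre
Prop. 21); the multiplicative prime `227 ∥ Δ` with `5 ∤ 1` lifts the image to `GL₂(ℤ/5^m)`).
[cite: Serre1972, §5.4 Prop. 21] [cite: SerreAbelianLadic1968, Ch. IV §3.4] -/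
theorem hasSurjectiveModNGaloisRep_pow_5 (m : ℕ) :
    ((⟨0, -1, 1, 0, 2⟩ : WeierstrassCurve ℤ).map (Int.castRingHom ℚ)).HasSurjectiveModNGaloisRep
      (5 ^ m : ℕ) := by
  have hn : ∀ t : ZMod 5, t ^ 2 - (((13 : ℕ) : ℤ) + 1 - (16 : ℕ) : ℤ) * t + ((13 : ℕ) : ZMod 5) ≠ 0 := by
    decide +kernel
  haveI := Fact.mk (by norm_num : Nat.Prime 5)
  haveI := Fact.mk (by norm_num : Nat.Prime 13)
  haveI := isElliptic_c681c1
  haveI := isGloballyMinimal_c681c1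
  exact hasSurjectiveModNGaloisRep_pow_of_intModel_certificate intModel
    (by rw [Int.isCoprime_iff_gcd_eq_one]; decide +kernel) 5 13 (by norm_num) (by decide +kernel)
    (n := 16) card_13 hn 227 (by norm_num) (by norm_num) (by decide +kernel) (by decide +kernel)
    (e := 1) (by decide +kernel) (by decide +kernel) (by decide +kernel) m

/-- **`681c1` is not CM** (multiplicative reduction at `227`; a CM curve has integral `j`).
[cite: SilvermanATAEC1994, Thm. II.6.4 (PDF p. 148)] [cite: CremonaAlgorithms1997, Table 1 (681c1)] -/
theorem not_hasCM :
    haveI := isElliptic_c681c1;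
    ¬ ((⟨0, -1, 1, 0, 2⟩ : WeierstrassCurve ℤ).map (Int.castRingHom ℚ)).HasCM := by
  haveI := isElliptic_c681c1
  haveI := isGloballyMinimal_c681c1
  haveI := Fact.mk (by norm_num : Nat.Prime 227)
  intro hCM
  exact not_hasMultiplicativeReductionAtPrime_of_hasCM _ hCM 227
    (IntModel.hasMultiplicativeReductionAtPrime_of_intModel intModel 227 (by decide +kernel)
      (by decide +kernel))

/-- **DEPTH-TABLE ROW `681c1`, `(p, d_K, ℓ) = (5, -83, 19)`, WITHOUT Kolyvagin's structure theorem**: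
for ANY imaginary quadratic `K` with `d_K = -83`, any frame `(Dt, β, ι)` and any COMPATIBLE system `d n`
of Kolyvagin–Heegner data, granted the five named McCallum/Gross leaves (Gross Prop. 5.4 (2);
McCallum Lemma 4.3, Prop. 4.4, Lemma 5.3, Prop. 2.2): the bit `(d 19).kolyvaginClass _ 1 ≠ 0` and one
rational point of infinite order on `E^{(-83)}` give `corank_{ℤ_5} Ш(E)[5^∞] = 0`,
`rank_ℤ E(ℚ) = 2`, `rank_ℤ E^{(-83)}(ℚ) = 1`, `corank_{ℤ_5} Ш(E^{(-83)})[5^∞] = 0`; every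
side condition (`5 ∈ B(E)`, non-CM, Heegner hypothesis, Kolyvagin prime, `2 ≤ rank`) is a kernel
theorem. Twin of `C681c1.depthRow_5_neg83_19` (file `…DepthTableRows3`, modulo `hF`).
CONDITIONAL on the five facts, the bit, the twist point; per-curve; BSD is not proved by it.
[cite: Kolyvagin1991MathAnn, Thm. 2.3] [cite: McCallumLMS1991, §§2–5]
[cite: JetchevLauterStein2009, §3.6 (arXiv:0707.0032)] -/
theorem depthRow_5_neg83_19_of_print
    (h54 : sign_conjAct_kolyvaginClass) (h43 : lemma43_kolyvaginClass_mem_selmerLocalKer)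
    (h44 : prop44_localOrder_kolyvaginClass_mul_eq) (h53 : lemma53_selmer_eigen_dependent_at)
    (h22 : prop22_reciprocity_eigen_finset)
    (K : Type) [Field K] [NumberField K] (hK : IsImaginaryQuadratic K)
    (hD : NumberField.discr K = -83) :
    haveI := isElliptic_c681c1;
    haveI := isGloballyMinimal_c681c1;
    haveI : NeZero (((⟨0, -1, 1, 0, 2⟩ : WeierstrassCurve ℤ).map (Int.castRingHom ℚ)).conductorNorm ℤ) :=
      neZero_conductorNorm_of_isElliptic _;
    ∀ (Dt : ModularParametrizationData ((⟨0, -1, 1, 0, 2⟩ : WeierstrassCurve ℤ).map (Int.castRingHom ℚ))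
        (((⟨0, -1, 1, 0, 2⟩ : WeierstrassCurve ℤ).map (Int.castRingHom ℚ)).conductorNorm ℤ)) (β : ℤ)
      (ι : K →+* ℂ) (d : ∀ m : ℕ, KolyvaginHeegnerData Dt β ι m),
    (∀ (m l : ℕ), ∀ l' ∈ m.primeFactors, ∀ (x : ringClassField K ι m)
      (x' : ringClassField K ι (m * l)),
      (x : ℂ) = x' → (((d (m * l)).σ l' x' : ringClassField K ι (m * l)) : ℂ) = ((d m).σ l' x : ℂ)) →
    (∀ (m l : ℕ), ∀ s ∈ (d m).S, ∃ s' ∈ (d (m * l)).S, ∀ (x : ringClassField K ι m)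
      (x' : ringClassField K ι (m * l)),
      (x : ℂ) = x' → ((s' x' : ringClassField K ι (m * l)) : ℂ) = (s x : ℂ)) →
    (∀ (m l : ℕ), ∀ s' ∈ (d (m * l)).S, ∃ s ∈ (d m).S, ∀ (x : ringClassField K ι m)
      (x' : ringClassField K ι (m * l)),
      (x : ℂ) = x' → ((s' x' : ringClassField K ι (m * l)) : ℂ) = (s x : ℂ)) →
    (∀ (m l : ℕ) (x : ringClassField K ι m) (x' : ringClassField K ι (m * l)),
      (x : ℂ) = x' → (d (m * l)).emb x' = (d m).emb x) →
    (d 19).kolyvaginClass (p := 5) (by norm_num) 1 ≠ 0 →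
    1 ≤ (((⟨0, -1, 1, 0, 2⟩ : WeierstrassCurve ℤ).map (Int.castRingHom ℚ)).quadraticTwist
      ((-83 : ℤ) : ℚ)).mordellWeilRank →
    ((⟨0, -1, 1, 0, 2⟩ : WeierstrassCurve ℤ).map (Int.castRingHom ℚ)).shaCorank 5 = 0 ∧
      ((⟨0, -1, 1, 0, 2⟩ : WeierstrassCurve ℤ).map (Int.castRingHom ℚ)).mordellWeilRank = 2 ∧
      (((⟨0, -1, 1, 0, 2⟩ : WeierstrassCurve ℤ).map (Int.castRingHom ℚ)).quadraticTwist
        ((-83 : ℤ) : ℚ)).mordellWeilRank = 1 ∧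
      (((⟨0, -1, 1, 0, 2⟩ : WeierstrassCurve ℤ).map (Int.castRingHom ℚ)).quadraticTwist
        ((-83 : ℤ) : ℚ)).shaCorank 5 = 0 := by
  haveI := isElliptic_c681c1
  haveI := isGloballyMinimal_c681c1
  haveI : NeZero (((⟨0, -1, 1, 0, 2⟩ : WeierstrassCurve ℤ).map (Int.castRingHom ℚ)).conductorNorm ℤ) :=
    neZero_conductorNorm_of_isElliptic _
  intro Dt β ι d hσ hS₁ hS₂ hemb hne htw
  haveI := Fact.mk (by norm_num : Nat.Prime 5)
  exact depthRow_of_print_of_intModel_certificate intModel h54 h43 h44 h53 h22 not_hasCM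
    KernelCerts002.C681c1.two_le_rank 5 (by norm_num) hasSurjectiveModNGaloisRep_pow_5 K hK hD
    (by norm_num) (by norm_num) heegner_neg83 19 (by norm_num) (by norm_num) (by decide +kernel)
    (by norm_num) (by norm_num) (by norm_num) (by norm_num) (n := 25) card_19 (by norm_num) Dt β ι
    d hσ hS₁ hS₂ hemb hne htw

end C681c1

/-! ## Row `707a1` = `[0,1,1,-12,12]` (`N = 707, |Δ| = 7²·101`): `(p, d_K, ℓ) = (5, -19, 179)` -/

namespace C707a1

/-- **`5 ∈ B(707a1)`: `ρ̄_{E,5^m}` onto for every `m`** (semistable `gcd(c₄, Δ) = 1`;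
`X² − a_3 X + 3`, `a_3 = -2`, root-free mod `5`: `E[5]` irreducible (Mazur 6.3), onto (Serre
Prop. 21); the multiplicative prime `101 ∥ Δ` with `5 ∤ 1` lifts the image to `GL₂(ℤ/5^m)`).
[cite: Serre1972, §5.4 Prop. 21] [cite: SerreAbelianLadic1968, Ch. IV §3.4] -/
theorem hasSurjectiveModNGaloisRep_pow_5 (m : ℕ) :
    ((⟨0, 1, 1, -12, 12⟩ : WeierstrassCurve ℤ).map (Int.castRingHom ℚ)).HasSurjectiveModNGaloisRep
      (5 ^ m : ℕ) := by
  have hn : ∀ t : ZMod 5, t ^ 2 - (((3 : ℕ) : ℤ) + 1 - (6 : ℕ) : ℤ) * t + ((3 : ℕ) : ZMod 5) ≠ 0 := by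
    decide +kernel
  haveI := Fact.mk (by norm_num : Nat.Prime 5)
  haveI := Fact.mk (by norm_num : Nat.Prime 3)
  haveI := isElliptic_c707a1
  haveI := isGloballyMinimal_c707a1
  exact hasSurjectiveModNGaloisRep_pow_of_intModel_certificate intModel
    (by rw [Int.isCoprime_iff_gcd_eq_one]; decide +kernel) 5 3 (by norm_num) (by decide +kernel)
    (n := 6) card_3 hn 101 (by norm_num) (by norm_num) (by decide +kernel) (by decide +kernel)
    (e := 1) (by decide +kernel) (by decide +kernel) (by decide +kernel) m

/-- **`707a1` is not CM** (multiplicative reduction at `101`; a CM curve has integral `j`).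
[cite: SilvermanATAEC1994, Thm. II.6.4 (PDF p. 148)] [cite: CremonaAlgorithms1997, Table 1 (707a1)] -/
theorem not_hasCM :
    haveI := isElliptic_c707a1;
    ¬ ((⟨0, 1, 1, -12, 12⟩ : WeierstrassCurve ℤ).map (Int.castRingHom ℚ)).HasCM := by
  haveI := isElliptic_c707a1
  haveI := isGloballyMinimal_c707a1
  haveI := Fact.mk (by norm_num : Nat.Prime 101)
  intro hCM
  exact not_hasMultiplicativeReductionAtPrime_of_hasCM _ hCM 101
    (IntModel.hasMultiplicativeReductionAtPrime_of_intModel intModel 101 (by decide +kernel)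
      (by decide +kernel))

/-- **DEPTH-TABLE ROW `707a1`, `(p, d_K, ℓ) = (5, -19, 179)`, WITHOUT Kolyvagin's structure theorem**:
for ANY imaginary quadratic `K` with `d_K = -19`, any frame `(Dt, β, ι)` and any COMPATIBLE system `d n`
of Kolyvagin–Heegner data, granted the five named McCallum/Gross leaves (Gross Prop. 5.4 (2);
McCallum Lemma 4.3, Prop. 4.4, Lemma 5.3, Prop. 2.2): the bit `(d 179).kolyvaginClass _ 1 ≠ 0` and one
rational point of infinite order on `E^{(-19)}` give `corank_{ℤ_5} Ш(E)[5^∞] = 0`,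
`rank_ℤ E(ℚ) = 2`, `rank_ℤ E^{(-19)}(ℚ) = 1`, `corank_{ℤ_5} Ш(E^{(-19)})[5^∞] = 0`; every
side condition (`5 ∈ B(E)`, non-CM, Heegner hypothesis, Kolyvagin prime, `2 ≤ rank`) is a kernel
theorem. Twin of `C707a1.depthRow_5_neg19_179` (file `…DepthTableRows4`, modulo `hF`).
CONDITIONAL on the five facts, the bit, the twist point; per-curve; BSD is not proved by it.
[cite: Kolyvagin1991MathAnn, Thm. 2.3] [cite: McCallumLMS1991, §§2–5]
[cite: JetchevLauterStein2009, §3.6 (arXiv:0707.0032)] -/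
theorem depthRow_5_neg19_179_of_print
    (h54 : sign_conjAct_kolyvaginClass) (h43 : lemma43_kolyvaginClass_mem_selmerLocalKer)
    (h44 : prop44_localOrder_kolyvaginClass_mul_eq) (h53 : lemma53_selmer_eigen_dependent_at)
    (h22 : prop22_reciprocity_eigen_finset)
    (K : Type) [Field K] [NumberField K] (hK : IsImaginaryQuadratic K)
    (hD : NumberField.discr K = -19) :
    haveI := isElliptic_c707a1;
    haveI := isGloballyMinimal_c707a1;
    haveI : NeZero (((⟨0, 1, 1, -12, 12⟩ : WeierstrassCurve ℤ).map (Int.castRingHom ℚ)).conductorNorm ℤ) :=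
      neZero_conductorNorm_of_isElliptic _;
    ∀ (Dt : ModularParametrizationData ((⟨0, 1, 1, -12, 12⟩ : WeierstrassCurve ℤ).map (Int.castRingHom ℚ))
        (((⟨0, 1, 1, -12, 12⟩ : WeierstrassCurve ℤ).map (Int.castRingHom ℚ)).conductorNorm ℤ)) (β : ℤ)
      (ι : K →+* ℂ) (d : ∀ m : ℕ, KolyvaginHeegnerData Dt β ι m),
    (∀ (m l : ℕ), ∀ l' ∈ m.primeFactors, ∀ (x : ringClassField K ι m)
      (x' : ringClassField K ι (m * l)),
      (x : ℂ) = x' → (((d (m * l)).σ l' x' : ringClassField K ι (m * l)) : ℂ) = ((d m).σ l' x : ℂ)) →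
    (∀ (m l : ℕ), ∀ s ∈ (d m).S, ∃ s' ∈ (d (m * l)).S, ∀ (x : ringClassField K ι m)
      (x' : ringClassField K ι (m * l)),
      (x : ℂ) = x' → ((s' x' : ringClassField K ι (m * l)) : ℂ) = (s x : ℂ)) →
    (∀ (m l : ℕ), ∀ s' ∈ (d (m * l)).S, ∃ s ∈ (d m).S, ∀ (x : ringClassField K ι m)
      (x' : ringClassField K ι (m * l)),
      (x : ℂ) = x' → ((s' x' : ringClassField K ι (m * l)) : ℂ) = (s x : ℂ)) →
    (∀ (m l : ℕ) (x : ringClassField K ι m) (x' : ringClassField K ι (m * l)),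
      (x : ℂ) = x' → (d (m * l)).emb x' = (d m).emb x) →
    (d 179).kolyvaginClass (p := 5) (by norm_num) 1 ≠ 0 →
    1 ≤ (((⟨0, 1, 1, -12, 12⟩ : WeierstrassCurve ℤ).map (Int.castRingHom ℚ)).quadraticTwist
      ((-19 : ℤ) : ℚ)).mordellWeilRank →
    ((⟨0, 1, 1, -12, 12⟩ : WeierstrassCurve ℤ).map (Int.castRingHom ℚ)).shaCorank 5 = 0 ∧
      ((⟨0, 1, 1, -12, 12⟩ : WeierstrassCurve ℤ).map (Int.castRingHom ℚ)).mordellWeilRank = 2 ∧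
      (((⟨0, 1, 1, -12, 12⟩ : WeierstrassCurve ℤ).map (Int.castRingHom ℚ)).quadraticTwist
        ((-19 : ℤ) : ℚ)).mordellWeilRank = 1 ∧
      (((⟨0, 1, 1, -12, 12⟩ : WeierstrassCurve ℤ).map (Int.castRingHom ℚ)).quadraticTwist
        ((-19 : ℤ) : ℚ)).shaCorank 5 = 0 := by
  haveI := isElliptic_c707a1
  haveI := isGloballyMinimal_c707a1
  haveI : NeZero (((⟨0, 1, 1, -12, 12⟩ : WeierstrassCurve ℤ).map (Int.castRingHom ℚ)).conductorNorm ℤ) :=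
    neZero_conductorNorm_of_isElliptic _
  intro Dt β ι d hσ hS₁ hS₂ hemb hne htw
  haveI := Fact.mk (by norm_num : Nat.Prime 5)
  exact depthRow_of_print_of_intModel_certificate intModel h54 h43 h44 h53 h22 not_hasCM
    KernelCerts002.C707a1.two_le_rank 5 (by norm_num) hasSurjectiveModNGaloisRep_pow_5 K hK hD
    (by norm_num) (by norm_num) heegner_neg19 179 (by norm_num) (by norm_num) (by decide +kernel)
    (by norm_num) (by norm_num) (by norm_num) (by norm_num) (n := 200) card_179 (by norm_num) Dt β ι
    d hσ hS₁ hS₂ hemb hne htw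

end C707a1

/-! ## Row `794a1` = `[1,0,1,-3,2]` (`N = 794, |Δ| = 2²·397`): `(p, d_K, ℓ) = (5, -23, 89)` -/

namespace C794a1

/-- **`5 ∈ B(794a1)`: `ρ̄_{E,5^m}` onto for every `m`** (semistable `gcd(c₄, Δ) = 1`;
`X² − a_3 X + 3`, `a_3 = -2`, root-free mod `5`: `E[5]` irreducible (Mazur 6.3), onto (Serre
Prop. 21); the multiplicative prime `397 ∥ Δ` with `5 ∤ 1` lifts the image to `GL₂(ℤ/5^m)`).
[cite: Serre1972, §5.4 Prop. 21] [cite: SerreAbelianLadic1968, Ch. IV §3.4] -/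
theorem hasSurjectiveModNGaloisRep_pow_5 (m : ℕ) :
    ((⟨1, 0, 1, -3, 2⟩ : WeierstrassCurve ℤ).map (Int.castRingHom ℚ)).HasSurjectiveModNGaloisRep
      (5 ^ m : ℕ) := by
  have hn : ∀ t : ZMod 5, t ^ 2 - (((3 : ℕ) : ℤ) + 1 - (6 : ℕ) : ℤ) * t + ((3 : ℕ) : ZMod 5) ≠ 0 := by
    decide +kernel
  haveI := Fact.mk (by norm_num : Nat.Prime 5)
  haveI := Fact.mk (by norm_num : Nat.Prime 3)
  haveI := isElliptic_c794a1
  haveI := isGloballyMinimal_c794a1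
  exact hasSurjectiveModNGaloisRep_pow_of_intModel_certificate intModel
    (by rw [Int.isCoprime_iff_gcd_eq_one]; decide +kernel) 5 3 (by norm_num) (by decide +kernel)
    (n := 6) card_3 hn 397 (by norm_num) (by norm_num) (by decide +kernel) (by decide +kernel)
    (e := 1) (by decide +kernel) (by decide +kernel) (by decide +kernel) m

/-- **`794a1` is not CM** (multiplicative reduction at `397`; a CM curve has integral `j`).
[cite: SilvermanATAEC1994, Thm. II.6.4 (PDF p. 148)] [cite: CremonaAlgorithms1997, Table 1 (794a1)] -/
theorem not_hasCM :
    haveI := isElliptic_c794a1;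
    ¬ ((⟨1, 0, 1, -3, 2⟩ : WeierstrassCurve ℤ).map (Int.castRingHom ℚ)).HasCM := by
  haveI := isElliptic_c794a1
  haveI := isGloballyMinimal_c794a1
  haveI := Fact.mk (by norm_num : Nat.Prime 397)
  intro hCM
  exact not_hasMultiplicativeReductionAtPrime_of_hasCM _ hCM 397
    (IntModel.hasMultiplicativeReductionAtPrime_of_intModel intModel 397 (by decide +kernel)
      (by decide +kernel))

/-- **DEPTH-TABLE ROW `794a1`, `(p, d_K, ℓ) = (5, -23, 89)`, WITHOUT Kolyvagin's structure theorem**: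
for ANY imaginary quadratic `K` with `d_K = -23`, any frame `(Dt, β, ι)` and any COMPATIBLE system `d n`
of Kolyvagin–Heegner data, granted the five named McCallum/Gross leaves (Gross Prop. 5.4 (2);
McCallum Lemma 4.3, Prop. 4.4, Lemma 5.3, Prop. 2.2): the bit `(d 89).kolyvaginClass _ 1 ≠ 0` and one
rational point of infinite order on `E^{(-23)}` give `corank_{ℤ_5} Ш(E)[5^∞] = 0`,
`rank_ℤ E(ℚ) = 2`, `rank_ℤ E^{(-23)}(ℚ) = 1`, `corank_{ℤ_5} Ш(E^{(-23)})[5^∞] = 0`; every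
side condition (`5 ∈ B(E)`, non-CM, Heegner hypothesis, Kolyvagin prime, `2 ≤ rank`) is a kernel
theorem. Twin of `C794a1.depthRow_5_neg23_89` (file `…DepthTableRows5`, modulo `hF`).
CONDITIONAL on the five facts, the bit, the twist point; per-curve; BSD is not proved by it.
[cite: Kolyvagin1991MathAnn, Thm. 2.3] [cite: McCallumLMS1991, §§2–5]
[cite: JetchevLauterStein2009, §3.6 (arXiv:0707.0032)] -/
theorem depthRow_5_neg23_89_of_print
    (h54 : sign_conjAct_kolyvaginClass) (h43 : lemma43_kolyvaginClass_mem_selmerLocalKer)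
    (h44 : prop44_localOrder_kolyvaginClass_mul_eq) (h53 : lemma53_selmer_eigen_dependent_at)
    (h22 : prop22_reciprocity_eigen_finset)
    (K : Type) [Field K] [NumberField K] (hK : IsImaginaryQuadratic K)
    (hD : NumberField.discr K = -23) :
    haveI := isElliptic_c794a1;
    haveI := isGloballyMinimal_c794a1;
    haveI : NeZero (((⟨1, 0, 1, -3, 2⟩ : WeierstrassCurve ℤ).map (Int.castRingHom ℚ)).conductorNorm ℤ) :=
      neZero_conductorNorm_of_isElliptic _;
    ∀ (Dt : ModularParametrizationData ((⟨1, 0, 1, -3, 2⟩ : WeierstrassCurve ℤ).map (Int.castRingHom ℚ))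
        (((⟨1, 0, 1, -3, 2⟩ : WeierstrassCurve ℤ).map (Int.castRingHom ℚ)).conductorNorm ℤ)) (β : ℤ)
      (ι : K →+* ℂ) (d : ∀ m : ℕ, KolyvaginHeegnerData Dt β ι m),
    (∀ (m l : ℕ), ∀ l' ∈ m.primeFactors, ∀ (x : ringClassField K ι m)
      (x' : ringClassField K ι (m * l)),
      (x : ℂ) = x' → (((d (m * l)).σ l' x' : ringClassField K ι (m * l)) : ℂ) = ((d m).σ l' x : ℂ)) →
    (∀ (m l : ℕ), ∀ s ∈ (d m).S, ∃ s' ∈ (d (m * l)).S, ∀ (x : ringClassField K ι m)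
      (x' : ringClassField K ι (m * l)),
      (x : ℂ) = x' → ((s' x' : ringClassField K ι (m * l)) : ℂ) = (s x : ℂ)) →
    (∀ (m l : ℕ), ∀ s' ∈ (d (m * l)).S, ∃ s ∈ (d m).S, ∀ (x : ringClassField K ι m)
      (x' : ringClassField K ι (m * l)),
      (x : ℂ) = x' → ((s' x' : ringClassField K ι (m * l)) : ℂ) = (s x : ℂ)) →
    (∀ (m l : ℕ) (x : ringClassField K ι m) (x' : ringClassField K ι (m * l)),
      (x : ℂ) = x' → (d (m * l)).emb x' = (d m).emb x) →
    (d 89).kolyvaginClass (p := 5) (by norm_num) 1 ≠ 0 →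
    1 ≤ (((⟨1, 0, 1, -3, 2⟩ : WeierstrassCurve ℤ).map (Int.castRingHom ℚ)).quadraticTwist
      ((-23 : ℤ) : ℚ)).mordellWeilRank →
    ((⟨1, 0, 1, -3, 2⟩ : WeierstrassCurve ℤ).map (Int.castRingHom ℚ)).shaCorank 5 = 0 ∧
      ((⟨1, 0, 1, -3, 2⟩ : WeierstrassCurve ℤ).map (Int.castRingHom ℚ)).mordellWeilRank = 2 ∧
      (((⟨1, 0, 1, -3, 2⟩ : WeierstrassCurve ℤ).map (Int.castRingHom ℚ)).quadraticTwist
        ((-23 : ℤ) : ℚ)).mordellWeilRank = 1 ∧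
      (((⟨1, 0, 1, -3, 2⟩ : WeierstrassCurve ℤ).map (Int.castRingHom ℚ)).quadraticTwist
        ((-23 : ℤ) : ℚ)).shaCorank 5 = 0 := by
  haveI := isElliptic_c794a1
  haveI := isGloballyMinimal_c794a1
  haveI : NeZero (((⟨1, 0, 1, -3, 2⟩ : WeierstrassCurve ℤ).map (Int.castRingHom ℚ)).conductorNorm ℤ) :=
    neZero_conductorNorm_of_isElliptic _
  intro Dt β ι d hσ hS₁ hS₂ hemb hne htw
  haveI := Fact.mk (by norm_num : Nat.Prime 5)
  exact depthRow_of_print_of_intModel_certificate intModel h54 h43 h44 h53 h22 not_hasCM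
    KernelCerts002.C794a1.two_le_rank 5 (by norm_num) hasSurjectiveModNGaloisRep_pow_5 K hK hD
    (by norm_num) (by norm_num) heegner_neg23 89 (by norm_num) (by norm_num) (by decide +kernel)
    (by norm_num) (by norm_num) (by norm_num) (by norm_num) (n := 90) card_89 (by norm_num) Dt β ι
    d hσ hS₁ hS₂ hemb hne htw

end C794a1

end Summit.BirchSwinnertonDyer.BirchSwinnertonDyer.Theorems.KolyvaginDepthDoor

end
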